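import Summits.Ventures.PercRepro.S1TrianglePlusFreeC
import Summits.Ventures.PercRepro.S1TrianglePlusPlane
import Summits.Ventures.PercRepro.S1TrianglePlus

/-!
# PercRepro — LEMMA T⁺⁺: the triangle count at bounded nullity under the line AND plane bounds
(p1, gen 20; a feeder lemma for SUBCLAIM-S1 §6.3 (a))

In a finite matroid satisfying (C1) (every rank-`2` set has `≤ 3` points) and (C2) (every set of rank `≤ 3`
has `≤ 6` points) the number `s₃` of triangles satisfies `2·s₃ + 3ν ≤ ν² + 8`, i.e.
`s₃ ≤ 3 + (ν − 1)(ν − 2)/2 = 3 · 3 · 4 · 6 · 9 · 13 · 18 · 24 · 31 · 39` at `ν = 1 … 10`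
(LEMMA T⁺ under (C1) alone: `1 · 2 · 4 · 7 · 11 · 16 · 22 · 29 · 37 · 46`; LEMMA T: `ν(ν + 1)/2`).

PROOF (deletion induction on `|E|`). Let `x` lie on a triangle, `t` the number of triangles through `x`
(`t ≤ ν`), `U` its cone (`|U| = 2t + 1`, `r(U) ≤ t + 1`).
* `t = ν`: T⁺'s cone lemma — every triangle contains `x`, `s₃ = ν`.
* `t = ν − 1`: then `r(U) ∈ {t, t + 1}`. If `r(U) = t` the cone carries all the nullity and the cone lemma with
  the plane bound (`S1TrianglePlusPlane`) gives `s₃ = t = ν − 1`; if `r(U) = t + 1` the cone is free with one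
  unit of nullity outside, and the free-cone lemma (`S1TrianglePlusFreeC`) gives `s₃ ≤ t + 2 = ν + 1`.
* `t ≤ ν − 2`: `s₃ ≤ t + s₃(M ＼ {x})` with `M ＼ {x}` of nullity `ν − 1` satisfying (C1) and (C2).
In every case `2·s₃ + 3ν ≤ ν² + 8` (`5ν ≤ ν² + 8`; `5ν − 2 ≤ ν² + 8`; `5ν + 2 ≤ ν² + 8` ⟸ `(ν−2)(ν−3) ≥ 0`;
and `2(ν − 2) + (ν−1)² + 8 − 3(ν−1) + 3ν = ν² + 8`).

* **`two_mul_ncard_triangles_add_three_mul_le`** — `2·#(triangles M) + 3d ≤ d·d + 8` when `|E| = r(E) + d`,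
  (C1) and (C2) hold;
* `ncard_triangles_le_of_nullity_plane` — the same as `#(triangles M) ≤ (d·d + 8 − 3d) / 2`.
Axioms: standard.
-/

open scoped Matroid

namespace PercRepro

namespace S1

open Set

variable {α : Type}

/-- The quadratic slack of the bound: `5d + 2 ≤ d² + 8` for every `d` (`(d − 2)(d − 3) ≥ 0`). -/
theorem five_mul_add_two_le_sq_add_eight (d : ℕ) : 5 * d + 2 ≤ d * d + 8 := by
  rcases Nat.lt_or_ge d 3 with h | h
  · interval_cases d <;> norm_num
  · obtain ⟨m, rfl⟩ : ∃ m, d = m + 3 := ⟨d - 3, by omega⟩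
    nlinarith [Nat.zero_le (m * m)]

/-- **LEMMA T⁺⁺ — the triangle count at bounded nullity under the line and plane bounds.** If `|E| = r(E) + d`,
every rank-`2` set has `≤ 3` points and every set of rank `≤ 3` has `≤ 6` points, then
`2·#(triangles M) + 3d ≤ d·d + 8`, i.e. `#(triangles M) ≤ 3 + (d − 1)(d − 2)/2`. -/
theorem two_mul_ncard_triangles_add_three_mul_le (M : Matroid α) [M.Finite]
    (hC1 : ∀ L ⊆ M.E, M.eRk L = 2 → L.ncard ≤ 3) (hC2 : ∀ P ⊆ M.E, M.eRk P ≤ 3 → P.ncard ≤ 6)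
    {d : ℕ} (hd : M.E.encard = M.eRank + d) :
    2 * (ThmN.triangles M).ncard + 3 * d ≤ d * d + 8 := by
  suffices H : ∀ n : ℕ, ∀ (M : Matroid α) [M.Finite], M.E.ncard = n →
      (∀ L ⊆ M.E, M.eRk L = 2 → L.ncard ≤ 3) → (∀ P ⊆ M.E, M.eRk P ≤ 3 → P.ncard ≤ 6) →
      ∀ d : ℕ, M.E.encard = M.eRank + d →
      2 * (ThmN.triangles M).ncard + 3 * d ≤ d * d + 8 from H _ M rfl hC1 hC2 d hd
  intro n
  induction n using Nat.strong_induction_on with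
  | _ n ih =>
  intro M _ hn hC1 hC2 d hd
  classical
  set S := ThmN.triangles M with hS
  have hSfin : S.Finite :=
    M.ground_finite.finite_subsets.subset (fun C hC => hC.1.subset_ground)
  have hdd : 3 * d ≤ d * d + 8 := by nlinarith
  by_cases hSe : S = ∅
  · rw [hSe, ncard_empty]; omega
  obtain ⟨C₀, hC₀⟩ := nonempty_iff_ne_empty.2 hSe
  obtain ⟨e, heC₀⟩ := hC₀.1.nonempty
  have heE : e ∈ M.E := hC₀.1.subset_ground heC₀
  -- `e` is not a loop (it lies on a `3`-element circuit)
  have hx : M.IsNonloop e := by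
    refine _root_.Matroid.isNonloop_of_not_isLoop heE ?_
    intro hloop
    have hC₀e : C₀ = {e} := hloop.eq_of_isCircuit_mem hC₀.1 heC₀
    have := hC₀.2
    rw [hC₀e, ncard_singleton] at this
    omega
  -- the triangles through `e` as a finset `s`, `t = #s ≤ d`
  set S₁ := ThmN.trianglesThrough M e with hS₁
  have hS₁fin : S₁.Finite := hSfin.subset (fun C hC => ⟨hC.1, hC.2.1⟩)
  set s := hS₁fin.toFinset with hsdef
  have hmem : ∀ C, C ∈ s ↔ C ∈ S₁ := fun C => Set.Finite.mem_toFinset hS₁fin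
  have hs : ∀ C ∈ s, C ∈ S₁ := fun C hC => (hmem C).1 hC
  have hscard : s.card = S₁.ncard := by rw [hsdef, ← Set.ncard_eq_toFinset_card _ hS₁fin]
  have h1 : S₁.ncard ≤ d := ThmN.ncard_trianglesThrough_le M hC1 hx hd
  -- the split of the triangles by whether they contain `e`
  set S₂ := {C | M.IsCircuit C ∧ C.ncard = 3 ∧ e ∉ C} with hS₂
  have hsplit : S ⊆ S₁ ∪ S₂ := by
    intro C hC
    by_cases h : e ∈ C
    · exact Or.inl ⟨hC.1, hC.2, h⟩
    · exact Or.inr ⟨hC.1, hC.2, h⟩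
  have hS₂fin : S₂.Finite := hSfin.subset (fun C hC => ⟨hC.1, hC.2.1⟩)
  have h3 : S.ncard ≤ S₁.ncard + S₂.ncard := by
    calc S.ncard ≤ (S₁ ∪ S₂).ncard := ncard_le_ncard hsplit (hS₁fin.union hS₂fin)
      _ ≤ S₁.ncard + S₂.ncard := ncard_union_le _ _
  have hS₂eq : S₂ = {T | T ∈ ThmN.triangles M ∧ e ∉ T} := by
    ext C; simp only [hS₂, ThmN.triangles, Set.mem_setOf_eq]; tauto
  -- CASE 1: `t = d` — T⁺'s cone lemma
  by_cases hcone : S₁.ncard = d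
  · have hS₁S : S = S₁ := by
      apply Set.Subset.antisymm
      · intro C hC
        exact ⟨hC.1, hC.2,
          mem_of_mem_triangles_of_ncard_trianglesThrough_eq M hC1 hx hd hcone hC⟩
      · intro C hC
        exact ⟨hC.1, hC.2.1⟩
    rw [hS₁S, hcone]
    have key := five_mul_add_two_le_sq_add_eight d
    omega
  -- the cone `U` and its numbers
  set U : Set α := {e} ∪ ⋃ C ∈ s, C with hU
  have hUE : U ⊆ M.E := by
    intro z hz
    rcases hz with hz | hz
    · rw [Set.mem_singleton_iff.1 hz]; exact hx.mem_ground
    · obtain ⟨C, hC, hzC⟩ := Set.mem_iUnion₂.1 hz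
      exact (hs C hC).1.subset_ground hzC
  have hUfin : U.Finite := M.ground_finite.subset hUE
  obtain ⟨hrU, hcU⟩ := ThmN.eRk_le_and_ncard_eq_of_triangles M hC1 hx s hs
  have hcU' : U.ncard = 1 + 2 * s.card := hcU
  have hrE : M.eRank ≤ M.eRk U + (M.E \ U).encard := by
    have := M.eRk_union_le_eRk_add_encard U (M.E \ U)
    rwa [Set.union_sdiff_cancel hUE, M.eRk_ground] at this
  have hcard : M.E.ncard = U.ncard + (M.E \ U).ncard := by
    conv_lhs => rw [← Set.union_sdiff_cancel hUE]
    exact Set.ncard_union_eq Set.disjoint_sdiff_right hUfin (M.ground_finite.sdiff)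
  have hneU : M.eRk U ≠ ⊤ := ((M.eRk_le_encard _).trans_lt hUfin.encard_lt_top).ne
  obtain ⟨a, ha⟩ := ENat.ne_top_iff_exists.1 hneU
  have hneR : M.eRank ≠ ⊤ :=
    (M.eRank_le_encard_ground.trans_lt M.ground_finite.encard_lt_top).ne
  obtain ⟨r, hr'⟩ := ENat.ne_top_iff_exists.1 hneR
  have e1 : r ≤ a + (M.E \ U).ncard := by
    rw [← ha, ← hr', ← (M.ground_finite.sdiff (t := U)).cast_ncard_eq] at hrE
    exact_mod_cast hrE
  have e2 : a ≤ 1 + s.card := by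
    rw [← ha] at hrU
    exact_mod_cast hrU
  have e3 : M.E.ncard = r + d := by
    rw [← hr', ← M.ground_finite.cast_ncard_eq] at hd
    exact_mod_cast hd
  -- CASE 2: `t = d − 1`
  by_cases hcone' : S₁.ncard + 1 = d
  · have hsd : s.card + 1 = d := by rw [hscard]; exact hcone'
    -- `a ∈ {t, t + 1}`
    have ha_ge : s.card ≤ a := by omega
    by_cases hafree : a = 1 + s.card
    · -- the free cone with one unit of nullity outside: at most two triangles avoid `e`
      have hfree : M.eRk U = ((1 + s.card : ℕ) : ℕ∞) := by rw [← ha, hafree]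
      have hd' : M.E.encard = M.eRank + ((s.card + 1 : ℕ) : ℕ∞) := by rw [hd, hsd]
      have h2 := ncard_triangles_not_mem_le_two M hC1 hx s hmem hfree hd'
      rw [← hS₂eq] at h2
      have key := five_mul_add_two_le_sq_add_eight d
      omega
    · -- `r(U) = t`: the cone carries all the nullity, every triangle contains `e`
      have ha_eq : a = s.card := by omega
      have hfull : M.eRk U + (M.E \ U).encard ≤ M.eRank := by
        rw [← ha, ← hr', ← (M.ground_finite.sdiff (t := U)).cast_ncard_eq]
        have : a + (M.E \ U).ncard ≤ r := by omega
        exact_mod_cast this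
      have hS₁S : S = S₁ := by
        apply Set.Subset.antisymm
        · intro C hC
          exact ⟨hC.1, hC.2,
            mem_of_mem_triangles_of_eRk_add_encard_le M hC1 hC2 hx s hmem hfull hC⟩
        · intro C hC
          exact ⟨hC.1, hC.2.1⟩
      rw [hS₁S]
      have key := five_mul_add_two_le_sq_add_eight d
      omega
  -- CASE 3: `t ≤ d − 2` — delete `e`
  have h1' : S₁.ncard + 2 ≤ d := by omega
  have hne : ¬ M.IsColoop e := hC₀.1.not_isColoop_of_mem heC₀
  have hν : M✶.eRank = (d : ℕ∞) := by
    have h := _root_.Matroid.eRank_add_eRank_dual M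
    rw [hd] at h
    exact WithTop.add_left_cancel (PercRepro.Matroid.eRank_ne_top_of_finite M) h
  have hdel := PercRepro.Matroid.dual_eRank_delete_singleton_add_one heE hne
  rw [hν] at hdel
  have hfin' : (M ＼ {e})✶.eRank ≠ ⊤ := by
    intro h
    rw [h] at hdel
    exact absurd hdel (by simp)
  obtain ⟨d', hd'⟩ := ENat.ne_top_iff_exists.1 hfin'
  have hdd' : d = d' + 1 := by
    rw [← hd'] at hdel
    exact_mod_cast hdel.symm
  have hd'enc : (M ＼ {e}).E.encard = (M ＼ {e}).eRank + d' := by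
    have h := _root_.Matroid.eRank_add_eRank_dual (M ＼ {e})
    rw [← hd'] at h
    exact h.symm
  have hdelE : (M ＼ {e}).E.ncard < n := by
    rw [_root_.Matroid.delete_ground, ← hn, ← ncard_sdiff_singleton_add_one heE M.ground_finite]
    omega
  have hC1' : ∀ L ⊆ (M ＼ {e}).E, (M ＼ {e}).eRk L = 2 → L.ncard ≤ 3 := by
    intro L hL hr
    rw [_root_.Matroid.delete_ground] at hL
    rw [delete_singleton_eRk_eq hL] at hr
    exact hC1 L (hL.trans sdiff_subset) hr
  have hC2' : ∀ P ⊆ (M ＼ {e}).E, (M ＼ {e}).eRk P ≤ 3 → P.ncard ≤ 6 := by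
    intro P hP hr
    rw [_root_.Matroid.delete_ground] at hP
    rw [delete_singleton_eRk_eq hP] at hr
    exact hC2 P (hP.trans sdiff_subset) hr
  have h2 : 2 * S₂.ncard + 3 * d' ≤ d' * d' + 8 := by
    have hsub : S₂ ⊆ ThmN.triangles (M ＼ {e}) := by
      intro C hC
      exact ⟨_root_.Matroid.delete_isCircuit_iff.2 ⟨hC.1, disjoint_singleton_right.2 hC.2.2⟩, hC.2.1⟩
    have hle : S₂.ncard ≤ (ThmN.triangles (M ＼ {e})).ncard :=
      ncard_le_ncard hsub
        ((M ＼ {e}).ground_finite.finite_subsets.subset (fun C hC => hC.1.subset_ground))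
    have := ih _ hdelE (M ＼ {e}) rfl hC1' hC2' d' hd'enc
    omega
  subst hdd'
  nlinarith [h1', h2, h3]

/-- LEMMA T⁺⁺ in the form `#(triangles M) ≤ (d·d + 8 − 3d) / 2` (`= 3 · 3 · 4 · 6 · 9 · 13 · 18 · 24` at
`d = 1 … 8`). -/
theorem ncard_triangles_le_of_nullity_plane (M : Matroid α) [M.Finite]
    (hC1 : ∀ L ⊆ M.E, M.eRk L = 2 → L.ncard ≤ 3) (hC2 : ∀ P ⊆ M.E, M.eRk P ≤ 3 → P.ncard ≤ 6)
    {d : ℕ} (hd : M.E.encard = M.eRank + d) :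
    (ThmN.triangles M).ncard ≤ (d * d + 8 - 3 * d) / 2 := by
  have := two_mul_ncard_triangles_add_three_mul_le M hC1 hC2 hd
  omega

end S1

end PercRepro
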